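import Literature.AlgebraicGeometry.ShimuraVarieties.UnitaryAuxiliaryCarrierBlocks
import HarnessLib

/-!
# Lattice vectors in `W₀ = M` and their multiplication matrices on `V_M` (split-lattice bookkeeping)

Bookkeeping for the SPLIT-LATTICE step of Deligne's auxiliary construction
[cite: Deligne1979ShimuraVarieties, Prop. 2.3.10 (PDF p. 32)], [cite: Deligne1971TravauxShimura, Prop. 1.15 p. 132]:
a lattice `Λ₀ = Γ₀⁻¹ℤ^{1×d} ⊂ W₀ = M` (in the coordinates `1 × b_k` of ★ `auxResW₀`) has the basis vectors
`c₀(m) = Σ_ι (Γ₀⁻¹)_{ι m} b_{ι.2} ∈ M` (`latticeVec`); multiplication by `c₀(m)` on `V_M = M³`, read along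
`eᵢ ⊗ b_k`, is the rational matrix `A_m = res_b(c₀(m) • 1₃)` (`latticeMul`).  We prove:

* `resMatrix_smul`, `resMatrix_map_tmul` — `R`-linearity of restriction of scalars and its compatibility
  with `M ↦ 𝔸_{ℚ,f} ⊗ M`; hence `latticeMul_map` (`A_m` over `𝔸_{ℚ,f}` is `res((1 ⊗ c₀ m) • 1₃)`) and
  `latticeMul_map_mul_auxResV` (`A_m` commutes with the `V`-corner `res(t′ • X′)` — scalars commute);
* `mul_tmul_latticeVec` — THE CHANGE-OF-BASIS IDENTITY: for `s ∈ 𝔸_{ℚ,f} ⊗ M`,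
  `s · (1 ⊗ c₀ l) = Σ_m (Γ₀ · res(s • 1₁) · Γ₀⁻¹)_{m l} · (1 ⊗ c₀ m)` (the matrix of multiplication by `s`
  in the basis `1 ⊗ c₀`);
* `resMatrix_sub_one_mul_latticeMul` — consequently, for a torus element `t′`,
  `res((t′ − 1) • 1₃) · A_l = Σ_m β_{m l} · A_m` with `β = Γ₀ · auxResW₀ t · Γ₀⁻¹ − 1` — the coefficient
  identity fed to ★ `isCongOne_conj_one_add_of_sum`;
* `sum_smul_latticeMul_eq` — `Σ_m z_m A_m = D • 1` whenever `Σ_m z_m c₀(m) = D` (an integer in `Λ₀`).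

Topic `AlgebraicGeometry/ShimuraVarieties`; namespace
`Literature.AlgebraicGeometry.ShimuraVarieties.UnitaryCanonicalModel.Aux`.  Two definitions with bodies
(`latticeVec`, `latticeMul`) and theorems; no named fact, no instance.
-/

set_option autoImplicit false

noncomputable section

open Matrix NumberField IsDedekindDomain
open scoped TensorProduct NumberField.AdeleRing

namespace Literature.AlgebraicGeometry.ShimuraVarieties.UnitaryCanonicalModel.Aux

open Literature.AlgebraicGeometry.ModuliOfAbelianVarieties
open Literature.NumberTheory.Automorphic Literature.NumberTheory.Automorphic.UnitaryGroup

/-! ### §1. Linearity of restriction of scalars -/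

section Res

variable {R S : Type} [CommRing R] [CommRing S] [Algebra R S] {κ : Type} [Fintype κ] [DecidableEq κ]
  {m : Type} [Fintype m] [DecidableEq m]

/-- Restriction of scalars is `R`-linear: `res_b(r • X) = r • res_b(X)`. [cite: Deligne1971TravauxShimura, 4.9 p. 147] -/
theorem resMatrix_smul (b : Module.Basis κ R S) (r : R) (X : Matrix m m S) :
    resMatrix b (r • X) = r • resMatrix b X := by
  ext ⟨i, k⟩ ⟨i', l⟩
  rw [resMatrix_apply, Matrix.smul_apply, Matrix.smul_apply, resMatrix_apply, smul_mul_assoc, map_smul,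
    Finsupp.smul_apply]

end Res

section Vectors

variable (M : Type) [Field M] [NumberField M]

/-- Restriction of scalars commutes with `M ↦ 𝔸_{ℚ,f} ⊗_ℚ M`: `res_{1⊗b}(1 ⊗ X) = (res_b X)_𝔸`.
[cite: Deligne1971TravauxShimura, 4.9 p. 147] -/
theorem resMatrix_map_tmul {n : Type} [Fintype n] [DecidableEq n] (X : Matrix n n M) :
    (resMatrix (ratBasis M) X).map (algebraMap ℚ finAdeleQ) =
      resMatrix (Algebra.TensorProduct.basis finAdeleQ (ratBasis M)) (X.map fun x => (1 : finAdeleQ) ⊗ₜ[ℚ] x) := by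
  ext ⟨i, k⟩ ⟨i', l⟩
  rw [Matrix.map_apply, resMatrix_apply, resMatrix_apply, Matrix.map_apply, Algebra.TensorProduct.basis_apply,
    Algebra.TensorProduct.tmul_mul_tmul, one_mul, Algebra.TensorProduct.basis_repr_tmul, Finsupp.smul_apply,
    Finsupp.mapRange_apply, smul_eq_mul, one_mul]

/-- `1 ⊗ (c • 1ₙ) = (1 ⊗ c) • 1ₙ` entrywise. [folklore] -/
private theorem map_tmul_smul_one {n : Type} [DecidableEq n] (c : M) :
    ((c • (1 : Matrix n n M)).map fun x => (1 : finAdeleQ) ⊗ₜ[ℚ] x) =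
      ((1 : finAdeleQ) ⊗ₜ[ℚ] c) • (1 : Matrix n n (finAdeleQ ⊗[ℚ] M)) := by
  ext i i'
  rw [Matrix.map_apply, Matrix.smul_apply, Matrix.smul_apply, Matrix.one_apply, Matrix.one_apply, smul_eq_mul,
    smul_eq_mul, mul_ite, mul_ite, mul_one, mul_zero, mul_one, mul_zero]
  split_ifs
  · rfl
  · exact TensorProduct.tmul_zero _ _

variable (Γ₀ : GL (Fin 1 × Fin (Module.finrank ℚ M)) ℚ)

/-- **The `m`-th basis vector `c₀(m) = Σ_ι (Γ₀⁻¹)_{ι m} · b_{ι.2} ∈ M` of the lattice `Λ₀ = Γ₀⁻¹ℤ^{1×d} ⊂ W₀`**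
(coordinates `1 × b_k` of ★ `auxResW₀`). [cite: PlatonovRapinchuk1994, §8.1] [cite: Deligne1971TravauxShimura, Prop. 1.15 p. 132] -/
def latticeVec (m : Fin 1 × Fin (Module.finrank ℚ M)) : M :=
  ∑ ι : Fin 1 × Fin (Module.finrank ℚ M),
    ((Γ₀⁻¹ : GL (Fin 1 × Fin (Module.finrank ℚ M)) ℚ) :
      Matrix (Fin 1 × Fin (Module.finrank ℚ M)) (Fin 1 × Fin (Module.finrank ℚ M)) ℚ) ι m • ratBasis M ι.2

/-- **Multiplication by `c₀(m)` on `V_M = M³` as a rational matrix `A_m = res_b(c₀(m) • 1₃)`** (index `3 × d`).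
[cite: Deligne1971TravauxShimura, 4.9 p. 147] -/
def latticeMul (m : Fin 1 × Fin (Module.finrank ℚ M)) :
    Matrix (Fin 3 × Fin (Module.finrank ℚ M)) (Fin 3 × Fin (Module.finrank ℚ M)) ℚ :=
  resMatrix (ratBasis M) (latticeVec M Γ₀ m • (1 : Matrix (Fin 3) (Fin 3) M))

/-- `A_m` over `𝔸_{ℚ,f}` is `res_{1⊗b}((1 ⊗ c₀ m) • 1₃)`. [cite: Deligne1971TravauxShimura, 4.9 p. 147] -/
theorem latticeMul_map (m : Fin 1 × Fin (Module.finrank ℚ M)) :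
    (latticeMul M Γ₀ m).map (algebraMap ℚ finAdeleQ) =
      resMatrix (Algebra.TensorProduct.basis finAdeleQ (ratBasis M))
        (((1 : finAdeleQ) ⊗ₜ[ℚ] latticeVec M Γ₀ m) • (1 : Matrix (Fin 3) (Fin 3) (finAdeleQ ⊗[ℚ] M))) := by
  rw [latticeMul, resMatrix_map_tmul, map_tmul_smul_one]

/-- The basis vector `1 ⊗ c₀(l)` expanded along `1 ⊗ b`: `1 ⊗ c₀(l) = Σ_ι (Γ₀⁻¹)_{ι l} · (1 ⊗ b_{ι.2})`.
[cite: PlatonovRapinchuk1994, §8.1] -/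
theorem tmul_latticeVec (l : Fin 1 × Fin (Module.finrank ℚ M)) :
    ((1 : finAdeleQ) ⊗ₜ[ℚ] latticeVec M Γ₀ l : finAdeleQ ⊗[ℚ] M) =
      ∑ ι : Fin 1 × Fin (Module.finrank ℚ M),
        algebraMap ℚ finAdeleQ (((Γ₀⁻¹ : GL (Fin 1 × Fin (Module.finrank ℚ M)) ℚ) :
          Matrix (Fin 1 × Fin (Module.finrank ℚ M)) (Fin 1 × Fin (Module.finrank ℚ M)) ℚ) ι l) •
          Algebra.TensorProduct.basis finAdeleQ (ratBasis M) ι.2 := by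
  rw [latticeVec, TensorProduct.tmul_sum]
  refine Finset.sum_congr rfl fun ι _ => ?_
  rw [TensorProduct.tmul_smul, Algebra.TensorProduct.basis_apply, algebraMap_smul]

/-- Multiplication by `s` on `𝔸_{ℚ,f} ⊗ M` in the basis `1 ⊗ b`, indexed by `1 × d`:
`s · (1 ⊗ b_{ι′.2}) = Σ_ι res(s • 1₁)_{ι ι′} · (1 ⊗ b_{ι.2})`. [cite: Deligne1971TravauxShimura, 4.9 p. 147] -/
theorem mul_basis_eq_sum_resMatrix (s : finAdeleQ ⊗[ℚ] M) (ι' : Fin 1 × Fin (Module.finrank ℚ M)) :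
    s * Algebra.TensorProduct.basis finAdeleQ (ratBasis M) ι'.2 =
      ∑ ι : Fin 1 × Fin (Module.finrank ℚ M),
        resMatrix (Algebra.TensorProduct.basis finAdeleQ (ratBasis M)) (s • (1 : Matrix (Fin 1) (Fin 1) (finAdeleQ ⊗[ℚ] M)))
          ι ι' • Algebra.TensorProduct.basis finAdeleQ (ratBasis M) ι.2 := by
  obtain ⟨i', k'⟩ := ι'
  have h : ∀ ι : Fin 1 × Fin (Module.finrank ℚ M),
      resMatrix (Algebra.TensorProduct.basis finAdeleQ (ratBasis M))
          (s • (1 : Matrix (Fin 1) (Fin 1) (finAdeleQ ⊗[ℚ] M))) ι (i', k') =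
        (Algebra.TensorProduct.basis finAdeleQ (ratBasis M)).repr
          (s * Algebra.TensorProduct.basis finAdeleQ (ratBasis M) k') ι.2 := by
    rintro ⟨i, k⟩
    obtain rfl : i = i' := Subsingleton.elim _ _
    rw [resMatrix_apply, Matrix.smul_apply, Matrix.one_apply_eq, smul_eq_mul, mul_one]
  simp_rw [h]
  rw [Fintype.sum_prod_type, Finset.univ_unique, Finset.sum_singleton]
  exact ((Algebra.TensorProduct.basis finAdeleQ (ratBasis M)).sum_repr _).symm

/-- **Change of basis to `1 ⊗ c₀`**: for `s ∈ 𝔸_{ℚ,f} ⊗ M`,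
`s · (1 ⊗ c₀ l) = Σ_m (Γ₀ · res(s • 1₁) · Γ₀⁻¹)_{m l} · (1 ⊗ c₀ m)` — the matrix of multiplication by `s` on
`W₀ ⊗ 𝔸_{ℚ,f}` in the lattice basis `c₀` is the `Γ₀`-conjugate of its matrix in the basis `b`.
[cite: PlatonovRapinchuk1994, §8.1] [cite: Deligne1971TravauxShimura, 4.9 p. 147] -/
theorem mul_tmul_latticeVec (s : finAdeleQ ⊗[ℚ] M) (l : Fin 1 × Fin (Module.finrank ℚ M)) :
    s * ((1 : finAdeleQ) ⊗ₜ[ℚ] latticeVec M Γ₀ l) =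
      ∑ m : Fin 1 × Fin (Module.finrank ℚ M),
        ((Γ₀ : Matrix (Fin 1 × Fin (Module.finrank ℚ M)) (Fin 1 × Fin (Module.finrank ℚ M)) ℚ).map
              (algebraMap ℚ finAdeleQ) *
            resMatrix (Algebra.TensorProduct.basis finAdeleQ (ratBasis M))
              (s • (1 : Matrix (Fin 1) (Fin 1) (finAdeleQ ⊗[ℚ] M))) *
            ((Γ₀⁻¹ : GL (Fin 1 × Fin (Module.finrank ℚ M)) ℚ) :
              Matrix (Fin 1 × Fin (Module.finrank ℚ M)) (Fin 1 × Fin (Module.finrank ℚ M)) ℚ).map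
              (algebraMap ℚ finAdeleQ)) m l •
          ((1 : finAdeleQ) ⊗ₜ[ℚ] latticeVec M Γ₀ m) := by
  classical
  -- abbreviations (generalised, to keep `Matrix` application type-correct)
  obtain ⟨e, he⟩ : ∃ e : Fin 1 × Fin (Module.finrank ℚ M) → finAdeleQ ⊗[ℚ] M,
      e = fun ι => Algebra.TensorProduct.basis finAdeleQ (ratBasis M) ι.2 := ⟨_, rfl⟩
  obtain ⟨R, hR⟩ : ∃ R : Matrix (Fin 1 × Fin (Module.finrank ℚ M)) (Fin 1 × Fin (Module.finrank ℚ M)) finAdeleQ,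
      R = resMatrix (Algebra.TensorProduct.basis finAdeleQ (ratBasis M))
        (s • (1 : Matrix (Fin 1) (Fin 1) (finAdeleQ ⊗[ℚ] M))) := ⟨_, rfl⟩
  obtain ⟨G, hG⟩ : ∃ G : Matrix (Fin 1 × Fin (Module.finrank ℚ M)) (Fin 1 × Fin (Module.finrank ℚ M)) finAdeleQ,
      G = ((Γ₀⁻¹ : GL (Fin 1 × Fin (Module.finrank ℚ M)) ℚ) :
        Matrix (Fin 1 × Fin (Module.finrank ℚ M)) (Fin 1 × Fin (Module.finrank ℚ M)) ℚ).map (algebraMap ℚ finAdeleQ) :=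
    ⟨_, rfl⟩
  obtain ⟨P, hP⟩ : ∃ P : Matrix (Fin 1 × Fin (Module.finrank ℚ M)) (Fin 1 × Fin (Module.finrank ℚ M)) finAdeleQ,
      P = (Γ₀ : Matrix (Fin 1 × Fin (Module.finrank ℚ M)) (Fin 1 × Fin (Module.finrank ℚ M)) ℚ).map
        (algebraMap ℚ finAdeleQ) := ⟨_, rfl⟩
  rw [← hR, ← hG, ← hP]
  have hGP : G * P = 1 := by
    rw [hG, hP, ← Matrix.map_mul, ← Units.val_mul, inv_mul_cancel, Units.val_one,
      Matrix.map_one _ (map_zero _) (map_one _)]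
  have hc : ∀ l, ((1 : finAdeleQ) ⊗ₜ[ℚ] latticeVec M Γ₀ l : finAdeleQ ⊗[ℚ] M) = ∑ ι, G ι l • e ι := fun l => by
    rw [tmul_latticeVec, hG, he]
    rfl
  have hb : ∀ ι' : Fin 1 × Fin (Module.finrank ℚ M), s * e ι' = ∑ ι, R ι ι' • e ι := fun ι' => by
    rw [he, hR]
    exact mul_basis_eq_sum_resMatrix M s ι'
  -- both sides equal `Σ_ι (R G)_{ι l} • e ι`
  have lhs : s * ((1 : finAdeleQ) ⊗ₜ[ℚ] latticeVec M Γ₀ l) = ∑ ι, (R * G) ι l • e ι := by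
    rw [hc, Finset.mul_sum]
    simp_rw [mul_smul_comm, hb, Finset.smul_sum, smul_smul]
    rw [Finset.sum_comm]
    refine Finset.sum_congr rfl fun ι _ => ?_
    rw [← Finset.sum_smul, Matrix.mul_apply]
    refine congrArg (· • e ι) (Finset.sum_congr rfl fun ι' _ => mul_comm _ _)
  have rhs : ∑ m, (P * R * G) m l • ((1 : finAdeleQ) ⊗ₜ[ℚ] latticeVec M Γ₀ m) = ∑ ι, (R * G) ι l • e ι := by
    simp_rw [hc, Finset.smul_sum, smul_smul]
    rw [Finset.sum_comm]
    refine Finset.sum_congr rfl fun ι _ => ?_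
    rw [← Finset.sum_smul]
    refine congrArg (· • e ι) ?_
    calc ∑ m, (P * R * G) m l * G ι m = (G * (P * R * G)) ι l := by
          rw [Matrix.mul_apply]
          exact Finset.sum_congr rfl fun m _ => mul_comm _ _
      _ = (R * G) ι l := by rw [Matrix.mul_assoc P, ← Matrix.mul_assoc G, hGP, Matrix.one_mul]
  rw [lhs, rhs]

/-- **`Σ_m z_m A_m = D • 1`** when `Σ_m z_m c₀(m) = D` (an integer point of `Λ₀` acts on `V_M` by the scalar `D`).
[cite: PlatonovRapinchuk1994, §8.1] -/
theorem sum_smul_latticeMul_eq {z : Fin 1 × Fin (Module.finrank ℚ M) → ℚ} {D : ℚ}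
    (hz : ∑ m, z m • latticeVec M Γ₀ m = algebraMap ℚ M D) :
    ∑ m, z m • latticeMul M Γ₀ m = D • (1 : Matrix (Fin 3 × Fin (Module.finrank ℚ M)) (Fin 3 × Fin (Module.finrank ℚ M)) ℚ) := by
  have h : ∑ m, z m • latticeMul M Γ₀ m =
      resMatrix (ratBasis M) ((∑ m, z m • latticeVec M Γ₀ m) • (1 : Matrix (Fin 3) (Fin 3) M)) := by
    rw [Finset.sum_smul, map_sum]
    refine Finset.sum_congr rfl fun m _ => ?_
    rw [latticeMul, smul_assoc, resMatrix_smul]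
  rw [h, hz, algebraMap_smul, resMatrix_smul, map_one]

variable [IsCMField M] {L : Type} [Field L] [NumberField L] [IsCMField L] (j : L →+* M) (H : Matrix (Fin 3) (Fin 3) L)

/-- **`A_m` commutes with the `V`-corner** `res(t′ • X′)` (scalars of `𝔸_{ℚ,f} ⊗ M` are central in `M₃`).
[cite: Deligne1979ShimuraVarieties, Prop. 2.3.10 (PDF p. 32)] -/
theorem latticeMul_map_mul_auxResV (m : Fin 1 × Fin (Module.finrank ℚ M))
    (p : ↥(finAdelic (↥(maximalRealSubfield L)) L (IsCMField.complexConj L) 3 H) × ↥(torusFinAdelic M)) :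
    (latticeMul M Γ₀ m).map (algebraMap ℚ finAdeleQ) *
        ((auxResV M j H p : GL (Fin 3 × Fin (Module.finrank ℚ M)) finAdeleQ) :
          Matrix (Fin 3 × Fin (Module.finrank ℚ M)) (Fin 3 × Fin (Module.finrank ℚ M)) finAdeleQ) =
      ((auxResV M j H p : GL (Fin 3 × Fin (Module.finrank ℚ M)) finAdeleQ) :
          Matrix (Fin 3 × Fin (Module.finrank ℚ M)) (Fin 3 × Fin (Module.finrank ℚ M)) finAdeleQ) *
        (latticeMul M Γ₀ m).map (algebraMap ℚ finAdeleQ) := by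
  rw [latticeMul_map, coe_auxResV, ← map_mul, ← map_mul, Matrix.smul_mul, Matrix.mul_smul, Matrix.one_mul,
    Matrix.mul_smul, Matrix.smul_mul, Matrix.mul_one, smul_comm]

variable {M Γ₀} in
/-- **The coefficient identity for the congruence brick**: for a torus element `t` with
`β := Γ₀ · auxResW₀ t · Γ₀⁻¹ − 1`, `res((t′ − 1) • 1₃) · A_l = Σ_m β_{m l} · A_m`.
[cite: Deligne1971TravauxShimura, Prop. 1.15 p. 132] -/
theorem resMatrix_sub_one_mul_latticeMul (t : ↥(torusFinAdelic M)) (l : Fin 1 × Fin (Module.finrank ℚ M)) :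
    resMatrix (Algebra.TensorProduct.basis finAdeleQ (ratBasis M))
          (((torusToTensorFin M t : finAdeleQ ⊗[ℚ] M) - 1) • (1 : Matrix (Fin 3) (Fin 3) (finAdeleQ ⊗[ℚ] M))) *
        (latticeMul M Γ₀ l).map (algebraMap ℚ finAdeleQ) =
      ∑ m : Fin 1 × Fin (Module.finrank ℚ M),
        ((Γ₀ : Matrix (Fin 1 × Fin (Module.finrank ℚ M)) (Fin 1 × Fin (Module.finrank ℚ M)) ℚ).map
                (algebraMap ℚ finAdeleQ) *
              ((auxResW₀ M t : GL (Fin 1 × Fin (Module.finrank ℚ M)) finAdeleQ) :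
                Matrix (Fin 1 × Fin (Module.finrank ℚ M)) (Fin 1 × Fin (Module.finrank ℚ M)) finAdeleQ) *
              ((Γ₀⁻¹ : GL (Fin 1 × Fin (Module.finrank ℚ M)) ℚ) :
                Matrix (Fin 1 × Fin (Module.finrank ℚ M)) (Fin 1 × Fin (Module.finrank ℚ M)) ℚ).map
                (algebraMap ℚ finAdeleQ) -
            1) m l •
          (latticeMul M Γ₀ m).map (algebraMap ℚ finAdeleQ) := by
  classical
  obtain ⟨s, hs⟩ : ∃ s : finAdeleQ ⊗[ℚ] M, s = (torusToTensorFin M t : finAdeleQ ⊗[ℚ] M) := ⟨_, rfl⟩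
  obtain ⟨P, hP⟩ : ∃ P : Matrix (Fin 1 × Fin (Module.finrank ℚ M)) (Fin 1 × Fin (Module.finrank ℚ M)) finAdeleQ,
      P = (Γ₀ : Matrix (Fin 1 × Fin (Module.finrank ℚ M)) (Fin 1 × Fin (Module.finrank ℚ M)) ℚ).map
        (algebraMap ℚ finAdeleQ) := ⟨_, rfl⟩
  obtain ⟨G, hG⟩ : ∃ G : Matrix (Fin 1 × Fin (Module.finrank ℚ M)) (Fin 1 × Fin (Module.finrank ℚ M)) finAdeleQ,
      G = ((Γ₀⁻¹ : GL (Fin 1 × Fin (Module.finrank ℚ M)) ℚ) :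
        Matrix (Fin 1 × Fin (Module.finrank ℚ M)) (Fin 1 × Fin (Module.finrank ℚ M)) ℚ).map (algebraMap ℚ finAdeleQ) :=
    ⟨_, rfl⟩
  rw [← hs, ← hP, ← hG]
  -- `(s - 1)(1 ⊗ c₀ l) = Σ_m β_{ml} (1 ⊗ c₀ m)`
  have hkey : (s - 1) * ((1 : finAdeleQ) ⊗ₜ[ℚ] latticeVec M Γ₀ l) =
      ∑ m, (P * ((auxResW₀ M t : GL (Fin 1 × Fin (Module.finrank ℚ M)) finAdeleQ) :
          Matrix (Fin 1 × Fin (Module.finrank ℚ M)) (Fin 1 × Fin (Module.finrank ℚ M)) finAdeleQ) * G - 1) m l •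
        ((1 : finAdeleQ) ⊗ₜ[ℚ] latticeVec M Γ₀ m) := by
    have h1 : ((1 : finAdeleQ) ⊗ₜ[ℚ] latticeVec M Γ₀ l : finAdeleQ ⊗[ℚ] M) =
        ∑ m, (1 : Matrix (Fin 1 × Fin (Module.finrank ℚ M)) (Fin 1 × Fin (Module.finrank ℚ M)) finAdeleQ) m l •
          ((1 : finAdeleQ) ⊗ₜ[ℚ] latticeVec M Γ₀ m) := by
      simp_rw [Matrix.one_apply, ite_smul, one_smul, zero_smul]
      rw [Finset.sum_ite_eq' Finset.univ l, if_pos (Finset.mem_univ l)]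
    rw [sub_mul, one_mul, mul_tmul_latticeVec M Γ₀ s l, hs, ← coe_auxResW₀, ← hP, ← hG]
    conv_lhs => rw [h1]
    rw [← Finset.sum_sub_distrib]
    refine Finset.sum_congr rfl fun m _ => ?_
    rw [Matrix.sub_apply, sub_smul]
  -- read the identity through `res((·) • 1₃)`
  calc resMatrix (Algebra.TensorProduct.basis finAdeleQ (ratBasis M)) ((s - 1) • (1 : Matrix (Fin 3) (Fin 3) (finAdeleQ ⊗[ℚ] M))) *
        (latticeMul M Γ₀ l).map (algebraMap ℚ finAdeleQ)
      = resMatrix (Algebra.TensorProduct.basis finAdeleQ (ratBasis M))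
          (((s - 1) * ((1 : finAdeleQ) ⊗ₜ[ℚ] latticeVec M Γ₀ l)) • (1 : Matrix (Fin 3) (Fin 3) (finAdeleQ ⊗[ℚ] M))) := by
        rw [latticeMul_map, ← map_mul, Matrix.smul_mul, Matrix.one_mul, smul_smul]
    _ = ∑ m, (P * ((auxResW₀ M t : GL (Fin 1 × Fin (Module.finrank ℚ M)) finAdeleQ) :
          Matrix (Fin 1 × Fin (Module.finrank ℚ M)) (Fin 1 × Fin (Module.finrank ℚ M)) finAdeleQ) * G - 1) m l •
        (latticeMul M Γ₀ m).map (algebraMap ℚ finAdeleQ) := by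
        rw [hkey, Finset.sum_smul, map_sum]
        refine Finset.sum_congr rfl fun m _ => ?_
        rw [smul_assoc, resMatrix_smul, latticeMul_map]

end Vectors

end Literature.AlgebraicGeometry.ShimuraVarieties.UnitaryCanonicalModel.Aux

end
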